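import Literature.AlgebraicGeometry.HodgeTheory.HodgeModelChernNormalised
import Literature.AlgebraicGeometry.HodgeTheory.ComplexConjugationHolds
import Literature.AlgebraicGeometry.HodgeTheory.LefschetzOneOneHeartOfCechIntegral
import Literature.AlgebraicGeometry.HodgeTheory.LefschetzOneOneCechIntegrality
import HarnessLib

/-!
# Chern-normalised Hodge models exist, and are normalised in degree `2` (Lefschetz `(1,1)` with no scalar)

Family `hodge`, layer `Literature/AlgebraicGeometry/HodgeTheory`. Theorems-only leaf companion of
`HodgeModelChernNormalised` (the definition `HodgeModel.IsChernNormalised A`: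
`A.deRham = (integrationDeRhamIsoFamily A.model) ⊗ ℂ`, de Rham's integration comparison), drawing
the two consequences whose inputs live behind heavy import cones:

* `HodgeModel.exists_isChernNormalised_holds` — **every smooth projective `X/ℂ` of dimension `n` has
  a Chern-normalised Hodge model**, with nothing assumed: the named fact `nonempty_hodgeModel n X` is
  discharged (`nonempty_hodgeModel_holds`, `ComplexConjugationHolds`: Serre GAGA §2, de Rham, the Hodge
  decomposition of compact Kähler manifolds), and any model is normalised by `HodgeModel.chernNormalise`.
  This is the companion existence statement requested with the definition (route
  `HodgeConjecture/HolomorphicityRate`, item `stmt-HodgeConjecture-10762`).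
* `HodgeModel.IsChernNormalised.isLefschetzOneOne` — **the comparison of a Chern-normalised model
  satisfies Lefschetz's theorem on `(1,1)`-classes in Chern–Weil form WITH NO SCALAR**
  (`ComplexDeRhamIsoFamily.IsLefschetzOneOne`, Voisin I Thm. 11.30 with Thm. 7.10 (i)): the tree's
  `isLefschetzOneOne_complexify_integration_of_cechIntegral` (`LefschetzOneOneHeartOfCechIntegral`) fed
  with the discharged Čech integrality step `CechCocycleIntegral_holds` (`LefschetzOneOneCechIntegrality`,
  Weil 1952 / Bott–Tu Thm. 8.9, 15.8). Read on the model itself: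
  `HodgeModel.IsChernNormalised.exists_isChernForm_of_isIntegralClass` — **for `X` smooth projective and
  `A` Chern-normalised, every INTEGRAL class `β ∈ H²(X^an; ℂ)` of type `(1,1)` (read in `A`) is EXACTLY
  `A.deRham[θ]` for the Chern form `θ` of a Hermitian holomorphic line bundle presented by a cocycle**
  — the degree-`2` normalisation "`[ω_{L,h}] = c₁(L)`" (Thm. 7.10 (i)) in the direction the tree has,
  i.e. the Lefschetz-`(1,1)` heart `β = μ • A.deRham[θ]` of `LefschetzOneOneChernWeil*` with `μ = 1`.

Also `HodgeModel.IsChernNormalised.chernCharacter_cocycle_zero` (`ch₀ = rank` for cocycle bundles,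
Kobayashi II (1.10)). No definition, no named fact (D-0026).

## References

* [VoisinHodgeI2002] C. Voisin, *Hodge Theory and Complex Algebraic Geometry I* (CUP 2002), §4.3.2
  Rem. 4.48, §6.1.3, Thm. 7.10, Thm. 11.30.
* [SerreGAGA1956] J.-P. Serre, *Géométrie algébrique et géométrie analytique*, Ann. Inst. Fourier 6
  (1956), §2 n°5 Prop. 2, n°7 Prop. 6.
* [BottTu1982Forms] R. Bott, L. W. Tu, *Differential Forms in Algebraic Topology* (1982), Thm. 8.9,
  Prop. 9.5, Thm. 15.8.
-/

noncomputable section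

open scoped Manifold ContDiff
open Literature.AlgebraicTopology.SingularHomology
open Literature.NumberTheory.Transcendental (complexDeRhamCohomology mem_cclosedSmoothForms
  ComplexDeRhamIsoFamily integrationDeRhamIsoFamily)
open Literature.Geometry.Kaehler (MForm HolomorphicLineBundle IsSmoothForm IsClosedForm
  SmoothComplexVectorBundle)

namespace Literature.AlgebraicGeometry.HodgeTheory

section HodgeTheory

variable {n : ℕ} {X : Motives.SchemeOver ℂ}

namespace HodgeModel

/-- **Smooth projective complex varieties have Chern-normalised Hodge models** (discharged): for `X`
smooth projective of dimension `n` over `ℂ` there is `A : HodgeModel n X` whose comparison family is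
de Rham's integration isomorphism, complexified (`nonempty_hodgeModel_holds` — Serre's
analytification, de Rham's theorem, the Hodge decomposition — then `chernNormalise`). Relies on:
nothing unproved. [cite: SerreGAGA1956, §2 n°5 Prop. 2 and n°7 Prop. 6]
[cite: VoisinHodgeI2002, §4.3.2 Rem. 4.48 and §6.1.3] -/
theorem exists_isChernNormalised_holds (hX : Motives.IsSmoothProjective n X) :
    ∃ A : HodgeModel n X, A.IsChernNormalised :=
  exists_isChernNormalised n X nonempty_hodgeModel_holds hX

/-- … together with reality (`HodgeModel.IsReal`) and Hodge symmetry of the same model.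
[cite: VoisinHodgeI2002, §6.1.3 Cor. 6.12] -/
theorem exists_isChernNormalised_isReal_holds (hX : Motives.IsSmoothProjective n X) :
    ∃ A : HodgeModel n X, A.IsChernNormalised ∧ A.IsReal ∧ A.IsHodgeSymmetric :=
  let ⟨A, hA⟩ := exists_isChernNormalised_holds hX
  ⟨A, hA, hA.isReal, hA.isHodgeSymmetric⟩

variable {A : HodgeModel n X}

/-- **A Chern-normalised comparison satisfies Lefschetz `(1,1)` in Chern–Weil form, with no scalar**
(`ComplexDeRhamIsoFamily.IsLefschetzOneOne`): on every holomorphic-atlas analytification `M` of a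
smooth projective `X'/ℂ` charted on `A.model`, every integral class in `A.deRham(H^{1,1})` is
`A.deRham[θ]` for the Chern form `θ` of a Hermitian holomorphic line bundle presented by a cocycle
(Voisin I Thm. 11.30 with Thm. 7.10 (i), for de Rham's integration comparison:
`isLefschetzOneOne_complexify_integration_of_cechIntegral` + `CechCocycleIntegral_holds`).
[cite: VoisinHodgeI2002, Thm. 11.30 and Thm. 7.10 (i)] [cite: BottTu1982Forms, Thm. 8.9, Prop. 9.5, Thm. 15.8] -/
theorem IsChernNormalised.isLefschetzOneOne (hA : A.IsChernNormalised) : A.deRham.IsLefschetzOneOne := by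
  rw [hA]
  exact isLefschetzOneOne_complexify_integration_of_cechIntegral CechCocycleIntegral_holds A.model

/-- **Degree-`2` normalisation of a Chern-normalised model (Lefschetz `(1,1)` heart with `μ = 1`).**
For `X` smooth projective of dimension `n` and `A` a Chern-normalised Hodge model of `X`, every
INTEGRAL class `β ∈ H²(X^an; ℂ)` lying in `A.hodgePQ 2 1 1` is EXACTLY the comparison image
`A.deRham[θ]` of the de Rham class of the Chern form `θ` (`IsChernForm`:
`θ|_{U_i} = (1/2iπ) ∂∂̄ log h_i`) of some Hermitian holomorphic line bundle `(L, h)` on `X^an`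
presented by a cocycle — "the class of the Chern form `ω_{L,h}` is equal to the image of `c₁(L)`"
(Thm. 7.10 (i)) combined with `Hdg²(X, ℤ) = im c₁` (Thm. 11.30), with no scalar because `A.deRham`
IS de Rham's comparison (for an arbitrary Hodge model the tree has only `β = μ • A.deRham[θ]`,
`lefschetzOneOne_chernWeil_of_rigidity`). [cite: VoisinHodgeI2002, Thm. 7.10 (i) and Thm. 11.30] -/
theorem IsChernNormalised.exists_isChernForm_of_isIntegralClass (hA : A.IsChernNormalised)
    (hX : Motives.IsSmoothProjective n X) (β : singularCohomology ℂ ℂ A.carrier 2)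
    (hβi : IsIntegralClass β) (hβ : β ∈ A.hodgePQ 2 1 1) :
    ∃ (ι : Type) (L : HolomorphicLineBundle ι A.model A.carrier) (h : L.HermitianMetric)
      (θ : MForm 𝓘(ℝ, A.model) A.carrier ℂ 2) (hs : IsSmoothForm θ) (hc : IsClosedForm θ),
      h.IsChernForm θ ∧
        β = A.deRham A.carrier 2
          (complexDeRhamCohomology.mk A.model A.carrier 2 ⟨θ, mem_cclosedSmoothForms hs hc⟩) :=
  hA.isLefschetzOneOne hX A.carrier A.toComplexPoints A.isAnalytification β hβi hβ

/-- **`ch₀(V) = r · 1`** for a `C^∞` complex vector bundle of rank `r` presented by a cocycle on a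
manifold charted on `A.model`, read through a Chern-normalised comparison (companion of
`IsChernNormalised.chernCharacter_zero`; Kobayashi II (1.10)). [cite: Kobayashi1987, Ch. II §1 (1.10)] -/
theorem IsChernNormalised.chernCharacter_cocycle_zero (hA : A.IsChernNormalised) {M : Type}
    [TopologicalSpace M] [ChartedSpace A.model M] [IsManifold 𝓘(ℝ, A.model) ∞ M] [T2Space M]
    [SigmaCompactSpace M] {ι : Type*} {r : ℕ} (V : SmoothComplexVectorBundle ι A.model M r) :
    V.chernCharacter A.deRham 0 = (r : ℂ) • singularCohomology.one ℂ M := by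
  rw [SmoothComplexVectorBundle.chernCharacter_zero, hA.deRham_one]

end HodgeModel

end HodgeTheory

end Literature.AlgebraicGeometry.HodgeTheory
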